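import Summits.BirchSwinnertonDyer.BirchSwinnertonDyer.Theses.LeadingTerm
import Summits.BirchSwinnertonDyer.BirchSwinnertonDyer.Theses.Squeeze
import Summits.BirchSwinnertonDyer.BirchSwinnertonDyer.Theses.HigherGrossZagier
import Summits.BirchSwinnertonDyer.BirchSwinnertonDyer.Theses.SelmerRank
import Summits.BirchSwinnertonDyer.BirchSwinnertonDyer.Theses.PAdicOrderV2
import Summits.BirchSwinnertonDyer.BirchSwinnertonDyer.Theorems.LeadingTermSqueezeUBR2StubTransport
import HarnessLib

/-!
# BirchSwinnertonDyer — crux `SqueezeUB` / `SqueezeUBR2` (stmt-BirchSwinnertonDyer-0145),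
# line `Sketch`: the crux is implied by the staffed cruxes of routes SelmerRank and PAdicOrderV2

Crux (`Summit.BirchSwinnertonDyer.BirchSwinnertonDyer.Theses.Squeeze.SqueezeUB` =
`…Theses.HigherGrossZagier.SqueezeUB` = `…Theses.LeadingTerm.SqueezeUBR2`, byte-identical):
**no excess rank**, `rank_ℤ E(ℚ) ≤ ord_{s=1} L(E,s)` for every elliptic `E/ℚ`; open for
`r_an ≥ 2`. Two registered sub-goals of line `Sketch` (`Cruxes/SqueezeUB/Lines/Sketch.lean`),
both sorry-free, recording that the crux is NOT an independent obligation of the summit: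

* `squeezeUB_of_selmerRank_items` — route SelmerRank's cruxes `SelmerRankUB` (stmt-0130:
  `corank_{ℤ_p} Sel_{p^∞}(E/ℚ) ≤ r_an` at every good ordinary `p ≥ 5` of surjective mod-`p` image)
  and `SelmerRankSmallImage` (stmt-14418: `corank = r_an` at every good ordinary `p ≥ 5` of
  non-surjective image) imply the crux — with NO further input: a global minimal model
  (`hasGlobalMinimalModel_rat_holds`), ONE good ordinary prime `p ≥ 5`
  (`exists_good_ordinary_prime_holds`), `rank ≤ corank Sel_{p^∞}` from the corank identity
  (`selmerCorank_eq_mordellWeilRank_add_holds`, Greenberg LNM 1716 §1) and the landed transport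
  stub TR (`stub_squeezeUB_transport`) are all tree THEOREMS. No modularity, no Kato, no
  Ш-finiteness, no height.
* `squeezeUB_of_padicOrderV2_items` — modularity (inlined antecedent, verbatim the hypothesis of
  `PAdicOrderV2.CruxesToThesis`) and route PAdicOrderV2's items `PAdicOrderKatoSideR2`
  (stmt-0491: `rank ≤ ord_{T=0} L_p` at odd good ordinary `p`, Kato Thm 18.4) and
  `PAdicOrderComparisonR2` (stmt-0489: `ord_{T=0} L_p = r_an` at every good ordinary `p`) imply
  the crux: `rank ≤ ord_T L_p = r_an` in `ℕ∞` at the prime of `exists_good_ordinary_prime_holds`.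

Each is restated under the three wanted_by names of the crux.
-/

set_option linter.dupNamespace false

namespace Summit.BirchSwinnertonDyer.BirchSwinnertonDyer.Theorems

open scoped MatrixGroups ModularForm
open CongruenceSubgroup Literature.NumberTheory.EllipticCurves
  Literature.NumberTheory.EllipticCurves.ModularForms WeierstrassCurve
open Summit.BirchSwinnertonDyer.BirchSwinnertonDyer.Theses.Squeeze (SqueezeUB)
open Summit.BirchSwinnertonDyer.BirchSwinnertonDyer.Theses.SelmerRank (SelmerRankUB
  SelmerRankSmallImage)
open Summit.BirchSwinnertonDyer.BirchSwinnertonDyer.Theses.PAdicOrderV2 (PAdicOrderKatoSideR2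
  PAdicOrderComparisonR2)

/-- **Crux `SqueezeUB` from route SelmerRank's cruxes.** `SelmerRankUB` (stmt-0130) and
`SelmerRankSmallImage` (stmt-14418) imply no excess rank for every elliptic `E/ℚ`: pass to a
global minimal model `C • W` (`hasGlobalMinimalModel_rat_holds`, Silverman AEC VIII.8.3), take a
good ordinary prime `p ≥ 5` (`exists_good_ordinary_prime_holds`), bound
`rank ≤ corank_{ℤ_p} Sel_{p^∞}` by the corank identity (`selmerCorank_eq_mordellWeilRank_add_holds`,
Greenberg LNM 1716 §1 pp. 54–57) and `corank ≤ r_an` by the item matching the image of `ρ̄_{E,p}`,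
then transport back by the landed stub TR (`stub_squeezeUB_transport`). [folklore] -/
theorem squeezeUB_of_selmerRank_items :
    SelmerRankUB → SelmerRankSmallImage → SqueezeUB := by
  intro hUB hSI W _
  obtain ⟨C, hC⟩ := WeierstrassCurve.hasGlobalMinimalModel_rat_holds W
  obtain ⟨p, hp, h5, hgood, hord⟩ := WeierstrassCurve.exists_good_ordinary_prime_holds (C • W)
  have hcor : (C • W).selmerCorank p ≤ (C • W).analyticRank := by
    by_cases hs : (C • W).HasSurjectiveModNGaloisRep p
    · exact hUB (C • W) p h5 hgood hord hs
    · exact (hSI (C • W) p h5 hgood hord hs).le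
  have hrk : (C • W).mordellWeilRank ≤ (C • W).selmerCorank p := by
    have h := (C • W).selmerCorank_eq_mordellWeilRank_add_holds p
    omega
  have hmin : (C • W).mordellWeilRank ≤ (C • W).analyticRank := hrk.trans hcor
  rw [(stub_squeezeUB_transport W C).1, (stub_squeezeUB_transport W C).2] at hmin
  exact hmin

/-- **Crux `SqueezeUB` from route PAdicOrderV2's items.** Modularity (inlined antecedent: every
elliptic `W` with `NeZero N_W` has a newform of level `N_W`; BCDT 2001 Thm A, tree fact
`exists_isNewformOf`), `PAdicOrderKatoSideR2` (stmt-0491: `rank ≤ ord_{T=0} L_p(f, α_p, T)` at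
every odd good ordinary prime; Kato, Astérisque 295, Thm 18.4) and `PAdicOrderComparisonR2`
(stmt-0489: `ord_{T=0} L_p = ord_{s=1} L(E,s)` at every good ordinary prime; Mazur–Tate–
Teitelbaum 1986 §II.10) imply no excess rank: on a global minimal model, at the good ordinary
prime `p ≥ 5` of `exists_good_ordinary_prime_holds`, `rank ≤ ord_T L_p = r_an` in `ℕ∞`;
transport by the landed stub TR. [folklore] -/
theorem squeezeUB_of_padicOrderV2_items :
    (∀ (W : WeierstrassCurve ℚ) [W.IsElliptic] [NeZero (W.conductorNorm ℤ)],
      ∃ f : CuspForm (Gamma0 (W.conductorNorm ℤ)) 2, IsNewformOf W f) →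
    PAdicOrderKatoSideR2 → PAdicOrderComparisonR2 → SqueezeUB := by
  intro hmod hK hC W _
  obtain ⟨C, hC'⟩ := WeierstrassCurve.hasGlobalMinimalModel_rat_holds W
  obtain ⟨p, hp, h5, hgood, hord⟩ := WeierstrassCurve.exists_good_ordinary_prime_holds (C • W)
  haveI hN : NeZero ((C • W).conductorNorm ℤ) := ⟨((C • W).conductorNorm_pos_holds).ne'⟩
  obtain ⟨f, hf⟩ := hmod (C • W)
  have hO : IsOrdinaryAt (C • W) p := ⟨hgood, hord⟩
  have h1 : ((C • W).mordellWeilRank : ℕ∞) ≤ (C • W).analyticRank :=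
    (hK (C • W) p (by omega) hO f hf).trans (hC (C • W) p hO f hf).le
  have hmin : (C • W).mordellWeilRank ≤ (C • W).analyticRank := by exact_mod_cast h1
  rw [(stub_squeezeUB_transport W C).1, (stub_squeezeUB_transport W C).2] at hmin
  exact hmin

/-- `squeezeUB_of_selmerRank_items` under the route-LeadingTerm name of the crux. [folklore] -/
theorem squeezeUBR2_of_selmerRank_items (hUB : SelmerRankUB) (hSI : SelmerRankSmallImage) :
    Summit.BirchSwinnertonDyer.BirchSwinnertonDyer.Theses.LeadingTerm.SqueezeUBR2 :=
  squeezeUB_of_selmerRank_items hUB hSI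

/-- `squeezeUB_of_selmerRank_items` under the route-HigherGrossZagier name of the crux.
[folklore] -/
theorem higherGZ_squeezeUB_of_selmerRank_items (hUB : SelmerRankUB)
    (hSI : SelmerRankSmallImage) :
    Summit.BirchSwinnertonDyer.BirchSwinnertonDyer.Theses.HigherGrossZagier.SqueezeUB :=
  squeezeUB_of_selmerRank_items hUB hSI

/-- `squeezeUB_of_padicOrderV2_items` under the route-LeadingTerm name of the crux. [folklore] -/
theorem squeezeUBR2_of_padicOrderV2_items
    (hmod : ∀ (W : WeierstrassCurve ℚ) [W.IsElliptic] [NeZero (W.conductorNorm ℤ)],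
      ∃ f : CuspForm (Gamma0 (W.conductorNorm ℤ)) 2, IsNewformOf W f)
    (hK : PAdicOrderKatoSideR2) (hC : PAdicOrderComparisonR2) :
    Summit.BirchSwinnertonDyer.BirchSwinnertonDyer.Theses.LeadingTerm.SqueezeUBR2 :=
  squeezeUB_of_padicOrderV2_items hmod hK hC

/-- `squeezeUB_of_padicOrderV2_items` under the route-HigherGrossZagier name of the crux.
[folklore] -/
theorem higherGZ_squeezeUB_of_padicOrderV2_items
    (hmod : ∀ (W : WeierstrassCurve ℚ) [W.IsElliptic] [NeZero (W.conductorNorm ℤ)],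
      ∃ f : CuspForm (Gamma0 (W.conductorNorm ℤ)) 2, IsNewformOf W f)
    (hK : PAdicOrderKatoSideR2) (hC : PAdicOrderComparisonR2) :
    Summit.BirchSwinnertonDyer.BirchSwinnertonDyer.Theses.HigherGrossZagier.SqueezeUB :=
  squeezeUB_of_padicOrderV2_items hmod hK hC

end Summit.BirchSwinnertonDyer.BirchSwinnertonDyer.Theorems
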